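import Mathlib
import Summits.ResolutionOfSingularities.ResolutionOfSingularities.Theorems.RadicialJungCleanModelsCleanProp44LeafOrderDivision
import HarnessLib

/-!
# Route `RadicialJung`, crux `CleanModels` (stmt-ResolutionOfSingularities-15917), line `Sketch` rev 35, stub 6 `stub_cleanProp44` (X44c):
# THE LEAF TOWER ON IDEALS — ✓ `…LeafOrderDivision` iterated along the `σ`-curves `Z_j` (census (iii-3), recipe step (1)), def-free

Seat decomp-res-hand-2 g21 (structural hand); the ideal-level twin of ✓ `leafSum_tower` (`…CleanProp44LeafTowerStep.lean`, elements).
Memo 4e §2.5: at a birth `c` with leaf `L = V(t)` and «`δ ≥ d`» (def-free surrogate `J ⊆ Σ_{e≤μ} (t^e)·𝔪^{(μ−e)d}`, ✓ `…LeafOrderDivision`),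
the tower «chart `u₁`: `t = t_j u₁^j`, `J_j = J·u₁^{−jμ}`» of divisions along `c`, then along the curves `Z_0 = E_c ∩ L̃`, `Z_{j+1} = E_{Z_j} ∩ L̃`
carries `J_j ⊆ Σ_{e≤μ} (t_j^e)·(u₁)^{(μ−e)(d−j)}` and «`Z_j` is near ⟺ `δ ≥ j + 2`».  ✓ `mem_sum_of_pow_mul_mem_map_of_weight` is ONE division for an
arbitrary ideal `𝔪` with `ψ(𝔪) ⊆ (v)`; since after the first division the weight ideal IS `(v)` (the exceptional parameter, carried along:
`ψ_j(v_j) = v_{j+1}`), the step iterates verbatim.  THIS FILE, for an abstract chain of ring maps `ψ_j : A_j → A_{j+1}` (stalk or chart maps of the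
successive blowings up — the instantiation is census (S)), with `ψ_j(t_j) = v_{j+1}·t_{j+1}` (strict transforms of the leaf) and CONTROLLED TRANSFORMS
`J_{j+1}` (every `x ∈ J_{j+1}` has `v_{j+1}^μ·x ∈ ψ_j(J_j)A_{j+1}` — e.g. ✓ `pow_mul_mem_map_of_mem_stalkIdeal_controlledTransform`):

* `leafOrder_tower` — **THE TOWER ON IDEALS**: `J_0 ⊆ Σ_{e≤μ} (t_0^e)·𝔪_0^{(μ−e)d}` with `ψ_0(𝔪_0) ⊆ (v_1)` ⟹ for `1 ≤ j ≤ d`: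
  `J_j ⊆ Σ_{e≤μ} (t_j^e)·(v_j)^{(μ−e)(d−j)}`.
* `leafOrder_tower_le_span_pair_pow` — **NEARNESS OF THE `σ`-CURVES**: for `1 ≤ j ≤ d − 1`, `J_j ⊆ (t_j, v_j)^μ` — the curve `Z_{j−1} = V(t_j, v_j)`
  (the intersection of the last exceptional divisor with the strict transform of the leaf) lies in the order-`μ` locus: «`δ ≥ (j−1) + 2` ⟹ `Z_{j−1}` near».
* `leafOrder_tower_le_span_pair_pow_maximalIdeal` — at a point `z` of a local ring `A_j` with `t_j, v_j ∈ 𝔪_z`: `J_j ⊆ 𝔪_z^μ`.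

So, with «`δ ≥ d`» at the birth, the `d − 1` curves `Z_0, …, Z_{d−2}` are successively NEAR (each a legitimate centre of the `μ`-elimination; clean-permissible by
✓ `cleanPermissibleAt_exceptional_of_side_mem`, exponent of `t_j` one), and the ideal side of recipe step (1) of the g20 memo is one theorem.  Honest framing:
OURS, elementary bookkeeping; the converse («`Z_j` near ⟹ `δ ≥ j + 2`», which needs Hironaka's `δ` EXACTLY, census (iii-1)) and every scheme-level
identification (census (S)) are NOT addressed; nothing here proves X44c, any case of `CleanModels`, or resolution of singularities in characteristic `p`.
[cite: CossartPiltant2008, Lemma 4.3 (4)–(5); Prop. 4.4 (proof, p. 11)] [cite: CossartJannsenSaito2020, Lemma 7.5, Def. 7.1]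
-/

noncomputable section

set_option linter.dupNamespace false -- mandated namespace of this single-conjunct summit

namespace Summit.ResolutionOfSingularities.ResolutionOfSingularities.Theorems.RadicialJung.CleanModels

section Tower

variable (Aj : ℕ → Type*) [∀ j, CommRing (Aj j)] (ψ : ∀ j, Aj j →+* Aj (j + 1)) (μ d : ℕ)
  (t v : ∀ j, Aj j) (J : ∀ j, Ideal (Aj j)) (𝔪₀ : Ideal (Aj 0))

/-- **THE LEAF TOWER ON IDEALS** (memo 4e §2.5 «`J_j = J·u₁^{−jμ}` after `j` divisions»).  Along a chain of ring maps `ψ_j : A_j → A_{j+1}` with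
`ψ_j(v_j) = v_{j+1}` non-zero-divisors (the exceptional parameter `u₁` carried along), `ψ_j(t_j) = v_{j+1}·t_{j+1}` (strict transforms of the leaf) and
controlled transforms `J_{j+1}` (`v_{j+1}^μ·x ∈ ψ_j(J_j)A_{j+1}` for `x ∈ J_{j+1}`): if `J_0 ⊆ Σ_{e≤μ} (t_0^e)·𝔪_0^{(μ−e)d}` («`δ ≥ d`») for an ideal `𝔪_0`
with `ψ_0(𝔪_0)A_1 ⊆ (v_1)` (the first centre), then for every `1 ≤ j ≤ d`: `J_j ⊆ Σ_{e≤μ} (t_j^e)·(v_j)^{(μ−e)(d−j)}`.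
[cite: CossartJannsenSaito2020, Lemma 7.5] [cite: CossartPiltant2008, Prop. 4.4 (proof, p. 11)] -/
theorem leafOrder_tower (hv : ∀ j, ψ j (v j) = v (j + 1)) (hvnzd : ∀ j, v (j + 1) ∈ nonZeroDivisors (Aj (j + 1)))
    (ht : ∀ j, ψ j (t j) = v (j + 1) * t (j + 1)) (hJ : ∀ j, ∀ x ∈ J (j + 1), v (j + 1) ^ μ * x ∈ (J j).map (ψ j))
    (h𝔪₀ : 𝔪₀.map (ψ 0) ≤ Ideal.span {v 1})
    (h0 : J 0 ≤ ∑ e ∈ Finset.range (μ + 1), Ideal.span {t 0 ^ e} * 𝔪₀ ^ ((μ - e) * d)) :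
    ∀ j, 1 ≤ j → j ≤ d → J j ≤ ∑ e ∈ Finset.range (μ + 1), Ideal.span {t j ^ e} * Ideal.span {v j} ^ ((μ - e) * (d - j)) := by
  intro j
  induction j with
  | zero => intro h; exact absurd h (by omega)
  | succ j ih =>
    intro _ hjd
    rcases Nat.eq_zero_or_pos j with rfl | hjpos
    · -- the first division, weight ideal `𝔪₀`
      intro x hx
      have h1 := mem_sum_of_pow_mul_mem_map_of_weight (ψ 0) 𝔪₀ (hvnzd 0) h𝔪₀ (ht 0) μ d (by omega) h0 (hJ 0 x hx)
      simpa using h1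
    · -- a later division, weight ideal `(v_j)`, weight `d − j`
      have hprev := ih hjpos (by omega)
      have h𝔪 : (Ideal.span {v j}).map (ψ j) ≤ Ideal.span {v (j + 1)} := by
        rw [Ideal.map_span, Set.image_singleton, hv]
      intro x hx
      have h1 := mem_sum_of_pow_mul_mem_map_of_weight (ψ j) (Ideal.span {v j}) (hvnzd j) h𝔪 (ht j) μ (d - j) (by omega)
        hprev (hJ j x hx)
      have h2 : d - j - 1 = d - (j + 1) := by omega
      rw [h2] at h1
      exact h1

/-- **NEARNESS OF THE `σ`-CURVES** (memo 4e §2.5 «`Z_j` is near ⟺ `δ ≥ j + 2`», direction ⟸): under the hypotheses of `leafOrder_tower`, for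
`1 ≤ j ≤ d − 1` the controlled transform satisfies `J_j ⊆ (t_j, v_j)^μ` — the curve `Z_{j−1} = V(t_j, v_j)` (last exceptional divisor ∩ strict
transform of the leaf) lies in the order-`μ` locus.  So «`δ ≥ d`» makes `Z_0, …, Z_{d−2}` successively near.
[cite: CossartPiltant2008, Lemma 4.3 (4)–(5); Prop. 4.4 (proof, p. 11)] -/
theorem leafOrder_tower_le_span_pair_pow (hv : ∀ j, ψ j (v j) = v (j + 1))
    (hvnzd : ∀ j, v (j + 1) ∈ nonZeroDivisors (Aj (j + 1)))
    (ht : ∀ j, ψ j (t j) = v (j + 1) * t (j + 1)) (hJ : ∀ j, ∀ x ∈ J (j + 1), v (j + 1) ^ μ * x ∈ (J j).map (ψ j))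
    (h𝔪₀ : 𝔪₀.map (ψ 0) ≤ Ideal.span {v 1})
    (h0 : J 0 ≤ ∑ e ∈ Finset.range (μ + 1), Ideal.span {t 0 ^ e} * 𝔪₀ ^ ((μ - e) * d))
    {j : ℕ} (hj1 : 1 ≤ j) (hjd : j + 1 ≤ d) :
    J j ≤ Ideal.span ({t j, v j} : Set (Aj j)) ^ μ := by
  have h1 := leafOrder_tower Aj ψ μ d t v J 𝔪₀ hv hvnzd ht hJ h𝔪₀ h0 j hj1 (by omega)
  refine le_span_pair_pow_of_le_sum (fun e => (μ - e) * (d - j)) (fun e he => ?_) h1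
  have h2 : (μ - e) * 1 ≤ (μ - e) * (d - j) := Nat.mul_le_mul_left _ (by omega)
  rw [mul_one] at h2
  omega

/-- Pointwise form: if `A_j` is a local ring and `t_j, v_j ∈ 𝔪` (a point `z` of `Z_{j−1}`), then `J_j ⊆ 𝔪^μ` for `1 ≤ j ≤ d − 1` — `z` is a near point
(`μ ≤ ord_z J_j`; with ✓ `le_idealOrder_iff` on the tree's stalks). [cite: CossartPiltant2008, Lemma 4.3 (4)–(5)] -/
theorem leafOrder_tower_le_maximalIdeal_pow (hv : ∀ j, ψ j (v j) = v (j + 1))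
    (hvnzd : ∀ j, v (j + 1) ∈ nonZeroDivisors (Aj (j + 1)))
    (ht : ∀ j, ψ j (t j) = v (j + 1) * t (j + 1)) (hJ : ∀ j, ∀ x ∈ J (j + 1), v (j + 1) ^ μ * x ∈ (J j).map (ψ j))
    (h𝔪₀ : 𝔪₀.map (ψ 0) ≤ Ideal.span {v 1})
    (h0 : J 0 ≤ ∑ e ∈ Finset.range (μ + 1), Ideal.span {t 0 ^ e} * 𝔪₀ ^ ((μ - e) * d))
    {j : ℕ} (hj1 : 1 ≤ j) (hjd : j + 1 ≤ d) [IsLocalRing (Aj j)]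
    (htm : t j ∈ IsLocalRing.maximalIdeal (Aj j)) (hvm : v j ∈ IsLocalRing.maximalIdeal (Aj j)) :
    J j ≤ IsLocalRing.maximalIdeal (Aj j) ^ μ := by
  refine (leafOrder_tower_le_span_pair_pow Aj ψ μ d t v J 𝔪₀ hv hvnzd ht hJ h𝔪₀ h0 hj1 hjd).trans (Ideal.pow_right_mono ?_ μ)
  rw [Ideal.span_le, Set.insert_subset_iff, Set.singleton_subset_iff]
  exact ⟨htm, hvm⟩

/-- **The top O-near level** `j = d − 1` (`d ≥ 2`): `J_{d−1} ⊆ Σ_{e≤μ} (t_{d−1}^e)·(v_{d−1})^{μ−e}` — every summand has weight exactly `μ`, the face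
weights of memo 4e §2.5 one division before the `δ`-face is read (`j* = δ − 2` is the index of the CURVE `Z_{d−2} = V(t_{d−1}, v_{d−1})`).
[cite: CossartPiltant2008, Prop. 4.4 (proof, p. 11)] -/
theorem leafOrder_tower_top (hv : ∀ j, ψ j (v j) = v (j + 1)) (hvnzd : ∀ j, v (j + 1) ∈ nonZeroDivisors (Aj (j + 1)))
    (ht : ∀ j, ψ j (t j) = v (j + 1) * t (j + 1)) (hJ : ∀ j, ∀ x ∈ J (j + 1), v (j + 1) ^ μ * x ∈ (J j).map (ψ j))
    (h𝔪₀ : 𝔪₀.map (ψ 0) ≤ Ideal.span {v 1})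
    (h0 : J 0 ≤ ∑ e ∈ Finset.range (μ + 1), Ideal.span {t 0 ^ e} * 𝔪₀ ^ ((μ - e) * d)) (hd : 2 ≤ d) :
    J (d - 1) ≤ ∑ e ∈ Finset.range (μ + 1), Ideal.span {t (d - 1) ^ e} * Ideal.span {v (d - 1)} ^ (μ - e) := by
  have h1 := leafOrder_tower Aj ψ μ d t v J 𝔪₀ hv hvnzd ht hJ h𝔪₀ h0 (d - 1) (by omega) (by omega)
  have h2 : d - (d - 1) = 1 := by omega
  simpa [h2] using h1

/-- **At the bottom** `j = d` (`d ≥ 1`) the weights vanish: `J_d ⊆ Σ_{e≤μ} (t_d^e)` carries no information on ideals (the `e = 0` summand is the unit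
ideal) — the `δ`-face is read on ELEMENTS (✓ `leafSum_tower_bottom`); recorded for the dictionary only. [folklore] -/
theorem leafOrder_tower_bottom (hv : ∀ j, ψ j (v j) = v (j + 1)) (hvnzd : ∀ j, v (j + 1) ∈ nonZeroDivisors (Aj (j + 1)))
    (ht : ∀ j, ψ j (t j) = v (j + 1) * t (j + 1)) (hJ : ∀ j, ∀ x ∈ J (j + 1), v (j + 1) ^ μ * x ∈ (J j).map (ψ j))
    (h𝔪₀ : 𝔪₀.map (ψ 0) ≤ Ideal.span {v 1})
    (h0 : J 0 ≤ ∑ e ∈ Finset.range (μ + 1), Ideal.span {t 0 ^ e} * 𝔪₀ ^ ((μ - e) * d)) (hd : 1 ≤ d) :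
    J d ≤ ∑ e ∈ Finset.range (μ + 1), Ideal.span {t d ^ e} * Ideal.span {v d} ^ 0 := by
  have h1 := leafOrder_tower Aj ψ μ d t v J 𝔪₀ hv hvnzd ht hJ h𝔪₀ h0 d hd le_rfl
  simpa using h1

end Tower

end Summit.ResolutionOfSingularities.ResolutionOfSingularities.Theorems.RadicialJung.CleanModels

end
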